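import Literature.AlgebraicGeometry.Motives.IntegralModelReductionMap
import Literature.AlgebraicGeometry.Motives.IntegralModelTensor
import Literature.AlgebraicGeometry.Motives.AbelianVarietyGoodReductionReductionMap
import HarnessLib

/-!
# The reduction map of a proper integral model: comparison with the abelian-scheme reduction map, products, Néron extensions
# ([SerreTate1968] §1 «the reduction map»; [BLRNeronModels1990] §1.2 Prop. 8; [Hartshorne1977] II.4.7)

Topic `Literature/AlgebraicGeometry/Motives`.  THEOREMS only (no def, no instance, no notation, no named fact, no `sorry`).  Cell
`hodgecm-mathlib` (D-0151), FLOOR 0, programme F0P5a (D9op road 2′, crux item stmt-HodgeConjecture-24832): piece **C2a″-cmp** (and the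
assembled C2a along a Néron extension) of the C2 package (planner ED4-CUT-LETTER §1/§8, steps 2 and 5 of the composition recipe).

For an abelian-scheme model `𝒜` of `B` at `v` (★ `IsAbelianSchemeModel B v 𝒜`, chosen generic isomorphism `e = h.exists_iso.choose`) the
bare integral model `⟨𝒜, e⟩ : IntegralModel 𝓞ᵥ K B.X` (= `h.goodReductionAt.model`, by `rfl`) has the group-free reduction map ★
`IntegralModel.geomReductionMap ⟨𝒜, e⟩ : B(Ω) → 𝒜_v(κ̄(v))` (`Ω = \overline{K_v}`).  We prove:

* `GoodReductionAt.toMul_geomReductionMap_eq_comp` — for ANY good-reduction datum `S` of `B`, `red_S = (red_{S.model} ∘ ι) ≫ S.reductionIso⁻¹`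
  (`rfl`: the two constructions are the same chain);
* **`IsAbelianSchemeModel.integralModel_geomReductionMap_eq`** — on `Ω`-points, `red_{⟨𝒜,e⟩} P` IS the tree's monoid homomorphism ★
  `h.reductionHom : B(Ω) →* 𝒜(κ(R))` read in `𝒜_v(κ̄(v))` through ★ `residueFieldPointsEquiv` and ★ `specialFibrePointsEquiv`; hence
  `red_{⟨𝒜,e⟩}` is multiplicative (`integralModel_geomReductionMap_mul`) and on `K̄`-points it is ★ `h.specialFibreReductionHom`
  (`integralModel_geomReductionMap_toAdicCompletionPoints`);
* `IntegralModel.isProper_tensor_total`, `IntegralModel.map_comp_genericIso'_hom_eq_of_μ` — the product model `𝒳.tensor 𝒴` is proper when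
  the factors are, and a `μ`-equation `μ ≫ 𝔞_K ≫ e_𝒵 = (e_𝒳 ⊗ e_𝒴) ≫ g` is the generic-fibre condition `𝔞_K ≫ e_𝒵 = e_{𝒳⊗𝒴} ≫ g` of ★
  `IntegralModel.geomReductionMap_map`;
* **`IsAbelianSchemeModel.integralModel_geomReductionMap_map_of_μ`** — for a smooth proper model `𝒮` of `X`, an `𝓞ᵥ`-morphism
  `𝔞 : 𝒮 ⊗ 𝒮 ⟶ 𝒜` with generic fibre `αd : X ⊗ X ⟶ B.X` (the `μ`-equation of the F0P5a letter `RecordCurveEichlerShimuraPointwise`) and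
  `x ∈ (X ⊗ X)(Ω)`: `red_{⟨𝒜,e⟩} (αd x) = 𝔞_v (red_{𝒮⊗𝒮} x)` (ED4 §8 step 2 «`ᾱ z = red_𝒜(αd(x,y))`»);
* `IsAbelianSchemeModel.integralModel_geomReductionMap_map_hom` — reduction of homomorphisms on `Ω`-points: `red (f P) = f̃ (red P)` with
  `f̃ = h.specialFibreHom h' f` (★ `genericFibre_map_neronLift_comp`, ★ `specialFibreHom_hom_hom_hom`; ED4 §8 step 2 «`𝒯̄ (red P) = red (𝒯 P)`»).

HC_CM is proved only modulo the 7 printed citations until rung 0 closes; this file is a generic leaf and changes no count.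

## References
* [SerreTate1968] J.-P. Serre, J. Tate, *Good reduction of abelian varieties*, Ann. of Math. 88 (1968), §1.
* [BLRNeronModels1990] S. Bosch, W. Lütkebohmert, M. Raynaud, *Néron Models*, Springer 1990, §1.2 Prop. 8.
* [Hartshorne1977] R. Hartshorne, *Algebraic Geometry*, II.4.7 (valuative criterion), II.3 Thm. 3.3, II Cor. 4.8.
* [Shimura1998] G. Shimura, *Abelian Varieties with Complex Multiplication and Modular Functions*, §11.1 Prop. 12.
-/

set_option autoImplicit false

noncomputable section

universe u

open CategoryTheory CategoryTheory.Limits AlgebraicGeometry MonoidalCategory IsDedekindDomain IsDedekindDomain.HeightOneSpectrum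
open scoped NumberField
open Literature.NumberTheory.EllipticCurves (genericFibre specGenericPoint)
open Literature.NumberTheory.GaloisRepresentations (closureValuationSubring)
open Literature.NumberTheory.DiophantineGeometry

namespace Literature.AlgebraicGeometry.Motives

/-! ### Any good-reduction datum: `red_S` is `red_{S.model}` followed by the reduction isomorphism -/

namespace AbelianVariety.GoodReductionAt

variable {K : Type} [Field K] [NumberField K] {v : HeightOneSpectrum (𝓞 K)} {B : AbelianVariety K}

/-- **`red_S = red_{S.model} ≫ S.reductionIso⁻¹`** for every good-reduction datum `S` of `B` at `v`: the datum's reduction map on a geometric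
point `x ∈ B(K̄)` is the group-free reduction map ★ `IntegralModel.geomReductionMap` of its model at the `Ω`-point `ι x`, read in
`S.reduction` through `S.reductionIso⁻¹` — the two constructions are the same chain (`rfl`). [cite: SerreTate1968, §1] -/
theorem toMul_geomReductionMap_eq_comp (S : B.GoodReductionAt v) (x : B.geomPoints) :
    Additive.toMul (S.geomReductionMap x) =
      (haveI := S.isProper_model
       S.model.geomReductionMap (toAdicCompletionPoints B v (Additive.toMul x))) ≫ S.reductionIso'.inv :=
  rfl

end AbelianVariety.GoodReductionAt

/-! ### Products of models: properness and the generic-fibre condition from a `μ`-equation -/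

namespace IntegralModel

section General

variable {R K : Type u} [CommRing R] [Field K] [Algebra R K] {X Y Z : SchemeOver K}

/-- The total space `𝒳 ⊗ 𝒴 → Spec R` of the product model is proper when `𝒳`, `𝒴` are (properness is stable under base change and
composition). [cite: Hartshorne1977, II Cor. 4.8] -/
theorem isProper_tensor_total (𝒳 : IntegralModel R K X) (𝒴 : IntegralModel R K Y) [IsProper 𝒳.total.hom] [IsProper 𝒴.total.hom] :
    IsProper (𝒳.tensor 𝒴).total.hom := by
  haveI : IsProper (pullback.fst 𝒳.total.hom 𝒴.total.hom) := MorphismProperty.pullback_fst _ _ ‹_›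
  change IsProper (𝒳.total ⊗ 𝒴.total).hom
  rw [Over.tensorObj_hom]
  exact MorphismProperty.comp_mem _ _ _ ‹IsProper (pullback.fst 𝒳.total.hom 𝒴.total.hom)› ‹_›

/-- **From the `μ`-equation to the generic-fibre condition.**  If `𝔞 : 𝒳 ⊗ 𝒴 ⟶ 𝒵` over `R` satisfies
`μ ≫ 𝔞_K ≫ e_𝒵 = (e_𝒳 ⊗ e_𝒴) ≫ g` (`μ` the cartesian-monoidal structure isomorphism of the generic-fibre functor), then
`𝔞_K ≫ e_𝒵 = e_{𝒳 ⊗ 𝒴} ≫ g` for the product model's generic isomorphism `e_{𝒳⊗𝒴} = μ⁻¹ ≫ (e_𝒳 ⊗ e_𝒴)`.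
[cite: Hartshorne1977, II.3 Thm. 3.3 (fibre product, universal property)] -/
theorem map_comp_genericIso_hom_eq_of_μ (𝒳 : IntegralModel R K X) (𝒴 : IntegralModel R K Y) (𝒵 : IntegralModel R K Z)
    (𝔞 : 𝒳.total ⊗ 𝒴.total ⟶ 𝒵.total) (g : X ⊗ Y ⟶ Z)
    (h𝔞 : Functor.LaxMonoidal.μ (genericFibre R K) 𝒳.total 𝒴.total ≫ (genericFibre R K).map 𝔞 ≫ 𝒵.genericIso.hom =
      (𝒳.genericIso.hom ⊗ₘ 𝒴.genericIso.hom) ≫ g) :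
    (genericFibre R K).map 𝔞 ≫ 𝒵.genericIso.hom = (𝒳.tensor 𝒴).genericIso.hom ≫ g := by
  rw [← cancel_epi (Functor.LaxMonoidal.μ (genericFibre R K) 𝒳.total 𝒴.total), h𝔞, ← μ_comp_tensor_genericIso_hom 𝒳 𝒴]
  exact Category.assoc _ _ _

end General

section NumberField

variable {K : Type} [Field K] [NumberField K] {v : HeightOneSpectrum (𝓞 K)} {X Y Z : SchemeOver K}

/-- The retyped generic-fibre condition: with `genericIso'` (★ `IntegralModel.genericIso'`, the generic isomorphism retyped at the
generic-fibre functor) on both sides, as consumed by ★ `IntegralModel.geomReductionMap_map`.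
[cite: Hartshorne1977, II.3 Thm. 3.3 (fibre product, universal property)] -/
theorem map_comp_genericIso'_hom_eq_of_μ (𝒳 : IntegralModel (valuationSubringAtPrime K v) K X)
    (𝒴 : IntegralModel (valuationSubringAtPrime K v) K Y) (𝒵 : IntegralModel (valuationSubringAtPrime K v) K Z)
    (𝔞 : 𝒳.total ⊗ 𝒴.total ⟶ 𝒵.total) (g : X ⊗ Y ⟶ Z)
    (h𝔞 : Functor.LaxMonoidal.μ (genericFibre (valuationSubringAtPrime K v) K) 𝒳.total 𝒴.total ≫
        (genericFibre (valuationSubringAtPrime K v) K).map 𝔞 ≫ 𝒵.genericIso'.hom = (𝒳.genericIso.hom ⊗ₘ 𝒴.genericIso.hom) ≫ g) :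
    (genericFibre (valuationSubringAtPrime K v) K).map 𝔞 ≫ 𝒵.genericIso'.hom = (𝒳.tensor 𝒴).genericIso'.hom ≫ g :=
  map_comp_genericIso_hom_eq_of_μ 𝒳 𝒴 𝒵 𝔞 g h𝔞

/-- **C2a along a morphism out of a product model** ([SerreTate1968] §1): for proper models `𝒳`, `𝒴`, `𝒵` and `𝔞 : 𝒳 ⊗ 𝒴 ⟶ 𝒵` with
generic fibre `g : X ⊗ Y ⟶ Z` in `μ`-form, `red_𝒵 (g x) = 𝔞_v (red_{𝒳⊗𝒴} x)` for every `x ∈ (X ⊗ Y)(Ω)`.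
[cite: SerreTate1968, §1] [cite: Hartshorne1977, II.4.7] -/
theorem geomReductionMap_map_tensor_of_μ (𝒳 : IntegralModel (valuationSubringAtPrime K v) K X)
    (𝒴 : IntegralModel (valuationSubringAtPrime K v) K Y) (𝒵 : IntegralModel (valuationSubringAtPrime K v) K Z)
    [IsProper 𝒳.total.hom] [IsProper 𝒴.total.hom] [IsProper 𝒵.total.hom]
    (𝔞 : 𝒳.total ⊗ 𝒴.total ⟶ 𝒵.total) (g : X ⊗ Y ⟶ Z)
    (h𝔞 : Functor.LaxMonoidal.μ (genericFibre (valuationSubringAtPrime K v) K) 𝒳.total 𝒴.total ≫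
        (genericFibre (valuationSubringAtPrime K v) K).map 𝔞 ≫ 𝒵.genericIso'.hom = (𝒳.genericIso.hom ⊗ₘ 𝒴.genericIso.hom) ≫ g)
    (x : AlgPoints (X ⊗ Y) (AlgebraicClosure (v.adicCompletion K))) :
    𝒵.geomReductionMap (AlgPoints.map g x) =
      AlgPoints.map ((specialFibreFunctor v).map 𝔞) (haveI := isProper_tensor_total 𝒳 𝒴; (𝒳.tensor 𝒴).geomReductionMap x) := by
  haveI := isProper_tensor_total 𝒳 𝒴
  exact geomReductionMap_map (𝒳.tensor 𝒴) 𝒵 𝔞 g (map_comp_genericIso'_hom_eq_of_μ 𝒳 𝒴 𝒵 𝔞 g h𝔞) x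

end NumberField

end IntegralModel

end Literature.AlgebraicGeometry.Motives

/-! ### The model of an abelian scheme: `red_{⟨𝒜, e⟩}` is the tree's reduction homomorphism -/

namespace Literature.NumberTheory.DiophantineGeometry

namespace IsAbelianSchemeModel

open Literature.AlgebraicGeometry.Motives Literature.AlgebraicGeometry.Motives.AbelianVariety
open Literature.NumberTheory.GaloisRepresentations (closureValuationSubring)
open scoped MonObj CategoryTheory.Obj

variable {K : Type} [Field K] [NumberField K] {v : HeightOneSpectrum (𝓞 K)} {A B : AbelianVariety K}
  {𝒜 : SchemeOver (valuationSubringAtPrime K v)} [GrpObj 𝒜] {ℬ : SchemeOver (valuationSubringAtPrime K v)} [GrpObj ℬ]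

/-- **`red_{⟨𝒜, e⟩} = h.reductionHom` on `Ω`-points** ([SerreTate1968] §1): for an abelian-scheme model `𝒜` of `B` at `v` and
`P ∈ B(Ω)`, the group-free reduction map of the bare model `⟨𝒜, e⟩` (★ `IntegralModel.geomReductionMap`; `= h.goodReductionAt.model` by
`rfl`) agrees with the tree's reduction homomorphism ★ `h.reductionHom : B(Ω) →* 𝒜(κ(R))` read in `𝒜_v(κ̄(v))` (★ `residueFieldPointsEquiv`,
★ `specialFibrePointsEquiv`): all layers agree (★ `modelPointsEquiv_symm_goodReductionAt`, ★ `reducePointMonoidHom_apply`).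
[cite: SerreTate1968, §1] [cite: Hartshorne1977, II.3 Thm. 3.3 (fibre product, universal property)] -/
theorem integralModel_geomReductionMap_eq (h : IsAbelianSchemeModel B v 𝒜) (P : B.Points (AlgebraicClosure (v.adicCompletion K))) :
    (haveI := h.isProper
     (⟨𝒜, h.exists_iso.choose⟩ : IntegralModel (valuationSubringAtPrime K v) K B.X).geomReductionMap P) =
      h.specialFibrePointsEquiv (residueFieldPointsEquiv v 𝒜 (h.reductionHom P)) := by
  haveI := h.isProper
  rw [h.specialFibrePointsEquiv_apply, h.reductionHom_apply, reducePointMonoidHom_apply, ← modelPointsEquiv_symm_goodReductionAt]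
  change (Over.mapPullbackAdj (specResidueField v)).homEquiv _ 𝒜
      ((geomClosedPointIso v).inv ≫ (geomClosedPointIsoSpecResidueField v).inv ≫
        (specRingHomι (closureValuationSubring (v.adicCompletion K)) (toClosureValuationSubring v)
            (IsLocalRing.residue (closureValuationSubring (v.adicCompletion K))) ≫
          extendPoint (closureValuationSubring (v.adicCompletion K)) (toClosureValuationSubring v) 𝒜
            (h.goodReductionAt.modelPointsEquiv.symm P))) =
    (Over.mapPullbackAdj (specResidueField v)).homEquiv _ 𝒜
      ((geomClosedPointIso v).inv ≫ (geomClosedPointIsoSpecResidueField v).inv ≫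
        (specRingHomι (closureValuationSubring (v.adicCompletion K)) (toClosureValuationSubring v)
            (IsLocalRing.residue (closureValuationSubring (v.adicCompletion K))) ≫
          extendPoint (closureValuationSubring (v.adicCompletion K)) (toClosureValuationSubring v) 𝒜
            (h.goodReductionAt.modelPointsEquiv.symm P)) ≫ (Iso.refl 𝒜).hom)
  rw [Iso.refl_hom, Category.comp_id]

/-- Additive reading: `ofMul (red_{⟨𝒜, e⟩} P) = h.additiveResidueFieldPointsEquiv (ofMul (h.reductionHom P))` in `𝒜_v.geomPoints`.
[cite: SerreTate1968, §1] -/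
theorem integralModel_geomReductionMap_eq_additive (h : IsAbelianSchemeModel B v 𝒜)
    (P : B.Points (AlgebraicClosure (v.adicCompletion K))) :
    (Additive.ofMul (haveI := h.isProper
     (⟨𝒜, h.exists_iso.choose⟩ : IntegralModel (valuationSubringAtPrime K v) K B.X).geomReductionMap P) : h.specialFibre.geomPoints) =
      h.additiveResidueFieldPointsEquiv (Additive.ofMul (h.reductionHom P)) := by
  apply Additive.toMul.injective
  change (haveI := h.isProper
     (⟨𝒜, h.exists_iso.choose⟩ : IntegralModel (valuationSubringAtPrime K v) K B.X).geomReductionMap P) =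
    h.specialFibrePointsEquiv (residueFieldPointsEquiv v 𝒜 (h.reductionHom P))
  exact h.integralModel_geomReductionMap_eq P

/-- **`red_{⟨𝒜, e⟩}` is a homomorphism on `Ω`-points** (it is the monoid homomorphism `h.reductionHom` up to the equivalences;
[SerreTate1968] §1 «the reduction map is a homomorphism»), additively written in `𝒜_v.geomPoints` (the currency of the F0P5a letters):
`red (P * Q) = red P + red Q`. [cite: SerreTate1968, §1] -/
theorem integralModel_geomReductionMap_mul (h : IsAbelianSchemeModel B v 𝒜)
    (P Q : B.Points (AlgebraicClosure (v.adicCompletion K))) :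
    (Additive.ofMul (haveI := h.isProper
      (⟨𝒜, h.exists_iso.choose⟩ : IntegralModel (valuationSubringAtPrime K v) K B.X).geomReductionMap (P * Q)) :
        h.specialFibre.geomPoints) =
      (Additive.ofMul (haveI := h.isProper
        (⟨𝒜, h.exists_iso.choose⟩ : IntegralModel (valuationSubringAtPrime K v) K B.X).geomReductionMap P) :
          h.specialFibre.geomPoints) +
      (Additive.ofMul (haveI := h.isProper
        (⟨𝒜, h.exists_iso.choose⟩ : IntegralModel (valuationSubringAtPrime K v) K B.X).geomReductionMap Q) :
          h.specialFibre.geomPoints) := by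
  rw [h.integralModel_geomReductionMap_eq_additive, h.integralModel_geomReductionMap_eq_additive,
    h.integralModel_geomReductionMap_eq_additive, map_mul, ofMul_mul, map_add]
  rfl

/-- `red_{⟨𝒜, e⟩} 1 = 0` (additively written). [cite: SerreTate1968, §1] -/
theorem integralModel_geomReductionMap_one (h : IsAbelianSchemeModel B v 𝒜) :
    (Additive.ofMul (haveI := h.isProper
      (⟨𝒜, h.exists_iso.choose⟩ : IntegralModel (valuationSubringAtPrime K v) K B.X).geomReductionMap 1) :
        h.specialFibre.geomPoints) = 0 := by
  rw [h.integralModel_geomReductionMap_eq_additive, map_one, ofMul_one, map_zero]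
  rfl

/-- `red_{⟨𝒜, e⟩} P⁻¹ = - red P` (additively written). [cite: SerreTate1968, §1] -/
theorem integralModel_geomReductionMap_inv (h : IsAbelianSchemeModel B v 𝒜) (P : B.Points (AlgebraicClosure (v.adicCompletion K))) :
    (Additive.ofMul (haveI := h.isProper
      (⟨𝒜, h.exists_iso.choose⟩ : IntegralModel (valuationSubringAtPrime K v) K B.X).geomReductionMap P⁻¹) :
        h.specialFibre.geomPoints) =
      -(Additive.ofMul (haveI := h.isProper
        (⟨𝒜, h.exists_iso.choose⟩ : IntegralModel (valuationSubringAtPrime K v) K B.X).geomReductionMap P) :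
          h.specialFibre.geomPoints) := by
  rw [h.integralModel_geomReductionMap_eq_additive, h.integralModel_geomReductionMap_eq_additive, map_inv, ofMul_inv, map_neg]
  rfl

/-- **On `K̄`-points `red_{⟨𝒜, e⟩} ∘ ι = red_v`**: for `x ∈ B(K̄)`, the group-free reduction of `ι x ∈ B(Ω)` is the tree's
`h.specialFibreReductionHom x` ([SerreTate1968] §1; all layers agree). [cite: SerreTate1968, §1] -/
theorem integralModel_geomReductionMap_toAdicCompletionPoints (h : IsAbelianSchemeModel B v 𝒜) (x : B.geomPoints) :
    (haveI := h.isProper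
     (⟨𝒜, h.exists_iso.choose⟩ : IntegralModel (valuationSubringAtPrime K v) K B.X).geomReductionMap
        (toAdicCompletionPoints B v (Additive.toMul x))) = Additive.toMul (h.specialFibreReductionHom x) := by
  rw [h.specialFibreReductionHom_apply, h.geomReductionHom_apply, ← h.integralModel_geomReductionMap_eq_additive]
  rfl

/-- The same through the produced datum: `red_{⟨𝒜,e⟩} (ι x) = toMul (h.goodReductionAt.geomReductionMap x)` (★
`geomReductionMap_goodReductionAt`). [cite: SerreTate1968, §1] -/
theorem integralModel_geomReductionMap_toAdicCompletionPoints' (h : IsAbelianSchemeModel B v 𝒜) (x : B.geomPoints) :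
    (haveI := h.isProper
     (⟨𝒜, h.exists_iso.choose⟩ : IntegralModel (valuationSubringAtPrime K v) K B.X).geomReductionMap
        (toAdicCompletionPoints B v (Additive.toMul x))) = Additive.toMul (h.goodReductionAt.geomReductionMap x) := by
  rw [h.geomReductionMap_goodReductionAt]
  exact h.integralModel_geomReductionMap_toAdicCompletionPoints x

/-! ### Reduction of homomorphisms and of Néron extensions on `Ω`-points -/

/-- **Reduction of homomorphisms on `Ω`-points** ([Shimura1998] §11.1 Prop. 12; [BLRNeronModels1990] §1.2 Prop. 8): for abelian-scheme
models `𝒜`, `ℬ` of `A`, `B` at `v`, a homomorphism `f : A ⟶ B` and `P ∈ A(Ω)`,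
`red_{⟨ℬ,e_ℬ⟩} (f P) = f̃_v (red_{⟨𝒜,e_𝒜⟩} P)` with `f̃_v = (specialFibreFunctor v).map (neronLift f)` the special fibre of the Néron lift
(★ `IntegralModel.geomReductionMap_map` at ★ `genericFibre_map_neronLift_comp`). [cite: Shimura1998, §11.1 Prop. 12]
[cite: BLRNeronModels1990, §1.2 Prop. 8] -/
theorem integralModel_geomReductionMap_map_hom (h : IsAbelianSchemeModel A v 𝒜) (h' : IsAbelianSchemeModel B v ℬ) (f : A ⟶ B)
    (P : A.Points (AlgebraicClosure (v.adicCompletion K))) :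
    (haveI := h'.isProper
     (⟨ℬ, h'.exists_iso.choose⟩ : IntegralModel (valuationSubringAtPrime K v) K B.X).geomReductionMap (AlgPoints.map f.hom.hom.hom P)) =
      AlgPoints.map ((specialFibreFunctor v).map (h.neronLift h' f))
        (haveI := h.isProper
         (⟨𝒜, h.exists_iso.choose⟩ : IntegralModel (valuationSubringAtPrime K v) K A.X).geomReductionMap P) := by
  haveI := h.isProper; haveI := h'.isProper
  exact IntegralModel.geomReductionMap_map (⟨𝒜, h.exists_iso.choose⟩ : IntegralModel (valuationSubringAtPrime K v) K A.X)
    ⟨ℬ, h'.exists_iso.choose⟩ (h.neronLift h' f) f.hom.hom.hom (h.genericFibre_map_neronLift_comp h' f) P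

/-- The same read in the geometric points of the special-fibre abelian varieties: `ofMul (red (f P)) = f̃ (ofMul (red P))` with
`f̃ = h.specialFibreHom h' f` (★ `specialFibreHom_hom_hom_hom`, ★ `Hom.geomPointsMap_apply`). [cite: Shimura1998, §11.1 Prop. 12] -/
theorem integralModel_geomReductionMap_map_hom_geomPointsMap (h : IsAbelianSchemeModel A v 𝒜) (h' : IsAbelianSchemeModel B v ℬ)
    (f : A ⟶ B) (P : A.Points (AlgebraicClosure (v.adicCompletion K))) :
    (Additive.ofMul (haveI := h'.isProper
     (⟨ℬ, h'.exists_iso.choose⟩ : IntegralModel (valuationSubringAtPrime K v) K B.X).geomReductionMap (AlgPoints.map f.hom.hom.hom P)) :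
        h'.specialFibre.geomPoints) =
      Hom.geomPointsMap (h.specialFibreHom h' f) (Additive.ofMul (haveI := h.isProper
         (⟨𝒜, h.exists_iso.choose⟩ : IntegralModel (valuationSubringAtPrime K v) K A.X).geomReductionMap P)) := by
  haveI := h.isProper; haveI := h'.isProper
  exact congrArg Additive.ofMul (h.integralModel_geomReductionMap_map_hom h' f P)

/-- **C2 assembled — reduction through a Néron extension out of a product model** ([SerreTate1968] §1; [BLRNeronModels1990] §1.2 Prop. 8;
F0P5a ED4 §8 step 2 «`ᾱ z = red_𝒜 (αd (x, y))`»).  For an abelian-scheme model `𝒜` of `B` at `v`, PROPER integral models `𝒳`, `𝒴` of `X`,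
`Y`, an `𝓞ᵥ`-morphism `𝔞 : 𝒳 ⊗ 𝒴 ⟶ 𝒜` whose generic fibre is `αd : X ⊗ Y ⟶ B.X` in the `μ`-form
`μ ≫ 𝔞_K ≫ e = (e_𝒳 ⊗ e_𝒴) ≫ αd` (verbatim the equation of the F0P5a letter `RecordCurveEichlerShimuraPointwise`, ★
`Albanese.exists_finite_forall_neronPackage`), and every `x ∈ (X ⊗ Y)(Ω)`:
`red_{⟨𝒜,e⟩} (αd x) = 𝔞_v (red_{𝒳⊗𝒴} x)`. [cite: SerreTate1968, §1] [cite: BLRNeronModels1990, §1.2 Prop. 8] [cite: Hartshorne1977, II.4.7] -/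
theorem integralModel_geomReductionMap_map_of_μ (h : IsAbelianSchemeModel B v 𝒜) {X Y : SchemeOver K}
    (𝒳 : IntegralModel (valuationSubringAtPrime K v) K X) (𝒴 : IntegralModel (valuationSubringAtPrime K v) K Y)
    [IsProper 𝒳.total.hom] [IsProper 𝒴.total.hom] (αd : X ⊗ Y ⟶ B.X) (𝔞 : 𝒳.total ⊗ 𝒴.total ⟶ 𝒜)
    (h𝔞 : Functor.LaxMonoidal.μ (genericFibre (valuationSubringAtPrime K v) K) 𝒳.total 𝒴.total ≫
        (genericFibre (valuationSubringAtPrime K v) K).map 𝔞 ≫ h.exists_iso.choose.hom = (𝒳.genericIso.hom ⊗ₘ 𝒴.genericIso.hom) ≫ αd)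
    (x : AlgPoints (X ⊗ Y) (AlgebraicClosure (v.adicCompletion K))) :
    (haveI := h.isProper
     (⟨𝒜, h.exists_iso.choose⟩ : IntegralModel (valuationSubringAtPrime K v) K B.X).geomReductionMap (AlgPoints.map αd x)) =
      AlgPoints.map ((specialFibreFunctor v).map 𝔞)
        (haveI := IntegralModel.isProper_tensor_total 𝒳 𝒴; (𝒳.tensor 𝒴).geomReductionMap x) := by
  haveI := h.isProper
  exact IntegralModel.geomReductionMap_map_tensor_of_μ 𝒳 𝒴 ⟨𝒜, h.exists_iso.choose⟩ 𝔞 αd h𝔞 x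

/-- Additive reading of `integralModel_geomReductionMap_map_of_μ` in `𝒜_v.geomPoints` (the currency of the F0P5a letter, whose terms are
`Additive.ofMul (AlgPoints.map ((specialFibreFunctor v).map 𝔞) z)`): `ofMul (red_{⟨𝒜,e⟩} (αd x)) = ofMul (𝔞_v (red_{𝒳⊗𝒴} x))`.
[cite: SerreTate1968, §1] [cite: BLRNeronModels1990, §1.2 Prop. 8] -/
theorem integralModel_geomReductionMap_map_of_μ_additive (h : IsAbelianSchemeModel B v 𝒜) {X Y : SchemeOver K}
    (𝒳 : IntegralModel (valuationSubringAtPrime K v) K X) (𝒴 : IntegralModel (valuationSubringAtPrime K v) K Y)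
    [IsProper 𝒳.total.hom] [IsProper 𝒴.total.hom] (αd : X ⊗ Y ⟶ B.X) (𝔞 : 𝒳.total ⊗ 𝒴.total ⟶ 𝒜)
    (h𝔞 : Functor.LaxMonoidal.μ (genericFibre (valuationSubringAtPrime K v) K) 𝒳.total 𝒴.total ≫
        (genericFibre (valuationSubringAtPrime K v) K).map 𝔞 ≫ h.exists_iso.choose.hom = (𝒳.genericIso.hom ⊗ₘ 𝒴.genericIso.hom) ≫ αd)
    (x : AlgPoints (X ⊗ Y) (AlgebraicClosure (v.adicCompletion K))) :
    (Additive.ofMul (haveI := h.isProper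
     (⟨𝒜, h.exists_iso.choose⟩ : IntegralModel (valuationSubringAtPrime K v) K B.X).geomReductionMap (AlgPoints.map αd x)) :
        h.specialFibre.geomPoints) =
      Additive.ofMul (AlgPoints.map ((specialFibreFunctor v).map 𝔞)
        (haveI := IntegralModel.isProper_tensor_total 𝒳 𝒴; (𝒳.tensor 𝒴).geomReductionMap x)) := by
  haveI := h.isProper
  exact congrArg Additive.ofMul (h.integralModel_geomReductionMap_map_of_μ 𝒳 𝒴 αd 𝔞 h𝔞 x)

/-- The smooth-proper case of the letter (`𝒮.IsSmoothProper 1` twice, one curve model on both factors), additive reading in `𝒜_v.geomPoints`: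
`ofMul (red_{⟨𝒜,e⟩} (αd x)) = ofMul (𝔞_v (red_{𝒮⊗𝒮} x))`. [cite: SerreTate1968, §1] [cite: BLRNeronModels1990, §1.2 Prop. 8] -/
theorem integralModel_geomReductionMap_map_of_μ_of_isSmoothProper (h : IsAbelianSchemeModel B v 𝒜) {X : SchemeOver K}
    (𝒮 : IntegralModel (valuationSubringAtPrime K v) K X) {d : ℕ} (h𝒮 : 𝒮.IsSmoothProper d) (αd : X ⊗ X ⟶ B.X)
    (𝔞 : 𝒮.total ⊗ 𝒮.total ⟶ 𝒜)
    (h𝔞 : Functor.LaxMonoidal.μ (genericFibre (valuationSubringAtPrime K v) K) 𝒮.total 𝒮.total ≫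
        (genericFibre (valuationSubringAtPrime K v) K).map 𝔞 ≫ h.exists_iso.choose.hom = (𝒮.genericIso.hom ⊗ₘ 𝒮.genericIso.hom) ≫ αd)
    (x : AlgPoints (X ⊗ X) (AlgebraicClosure (v.adicCompletion K))) :
    (haveI := h.isProper
     (⟨𝒜, h.exists_iso.choose⟩ : IntegralModel (valuationSubringAtPrime K v) K B.X).geomReductionMap (AlgPoints.map αd x)) =
      AlgPoints.map ((specialFibreFunctor v).map 𝔞) (haveI := (h𝒮.tensor h𝒮).2; (𝒮.tensor 𝒮).geomReductionMap x) := by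
  haveI := h𝒮.2
  exact h.integralModel_geomReductionMap_map_of_μ 𝒮 𝒮 αd 𝔞 h𝔞 x

end IsAbelianSchemeModel

end Literature.NumberTheory.DiophantineGeometry

end
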